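import Summits.CriticalPhenomena.CardyFormulaZ2.Theorems.CardyComplexConeEdgePrecompactUFRSAnnulusCrossings

/-!
# The events of the UFRS certificate: strand-crossing families, the multi-scale collar certificate, arm families
(line `qkz-strip-boundary-arm` of crux `CardyComplexCone.EdgePrecompact`, stmt-CriticalPhenomena-11387;
vocabulary of the corrected items 3–5 of the road map for the uniform forward response stability
"UFRS", see the module docstring of `…EdgePrecompactUFRSAnnulusCrossings.lean`)

Definitions only (and their unfolding lemmas), consumed by the registered sub-goals
`ufrs_armDomination2` (deterministic domination of the UFRS failure event by `ufrsCert` at a collar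
point), `ufrs_screenedCollarDecay(_rect)` / `ufrs_markedPointDecay(_rect)` (decay of its branches),
`ufrs_strands_zdDomArms` (strands ⇒ `ufrsArms`) and the proved glue `ufrs_of_pieces`.

* `ufrsStrands E w ω z k r R` — a family of `k` STRAND-CROSSINGS of the annulus `A(z; r, R)`:
  pairwise corner-disjoint, individually simple stretches of orbits of Smirnov's successor map,
  the `a`-th one of the completed configuration `E.bcBondConfig ω` through `E`-inner faces
  (`τ a = true`) or of `(shiftData E w).bcBondConfig ω` through `(shiftData E w)`-inner faces
  (`τ a = false`), each joining (in either direction) a vertex within `r` of `z` to a vertex at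
  distance `≥ R` from `z`.
* `ufrsNearMarked E w z ρ'` — some `A`–`B` edge of `E` or of `shiftData E w` has its midpoint
  within `ρ'` of `z` (the marked points `a_δ, b_δ` and their translates).
* `ufrsCertFar`, `ufrsCertMarked`, `ufrsCertNear`, `ufrsCert` — the multi-scale certificate at a
  collar point `z` with inner radius `r` (`= 4η`) and outer radius `R` (`= ρ/2`): escape
  `R < 256 r`; FAR: a dyadic `d ∈ [r, R/32]` with (if `2r ≤ d`) three strand-crossings of
  `A(z; r, d/2)` and three of `A(z; 2d, R/2)`; MARKED: the same with a dyadic outer radius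
  `R' < R/2`, a marked edge within `4R'` and two strand-crossings of `A(z; 8R', R/2)`; NEAR: a
  marked edge within `64 r` and two strand-crossings of `A(z; 128 r, R/2)`. Why these scales:
  the divergent parts of the two orbits either reach far (one scale) or are confined near `z`, and
  then the turning rigidity (`ufrs_bigonTurning`) forces a second family of crossings at the larger
  scale; near the marked points only two crossings survive at the largest scale.
* `ufrsArms β δ z k r R` — `k` ARMS of ONE configuration `β` across `A(z; r, R)` (tolerance
  `4δ`): open arms are lattice walks of `β`-open edges, dual arms are face walks whose steps cross
  edges outside `β` (`sepEdge`), not all of the same colour, same-colour arms edge-disjoint — the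
  conclusion of the sector lemma `ufrs_strands_zdDomArms`, in the format of `Z2HalfPlane.threeArm`.

References: S. Smirnov, C. R. Acad. Sci. Paris 333 (2001), §2; P. Nolin, Electron. J. Probab. 13
(2008), §4 (arm events); G. F. Lawler, O. Schramm, W. Werner, Electron. J. Probab. 7 (2002), App. A.
-/

namespace Summit.CriticalPhenomena.CardyFormulaZ2.Cruxes.EdgePrecompact.QkzStripBoundaryArm

open MeasureTheory Filter Set Metric
open scoped Topology BigOperators Pointwise
open Literature.Probability.LatticeModels Literature.Probability.Percolation
open Literature.Probability.RandomPlanarGeometry (DobrushinDomain)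
open Summit.CriticalPhenomena.CardyFormulaZ2.Theses.CardyComplexCone

noncomputable section

/-- **A family of `k` strand-crossings of the annulus `A(z; r, R)`** for the pair of data `E`,
`shiftData E w`, as an event: corners `c a`, index ranges `[i a, j a]` and tags `τ a` such that
the `a`-th stretch of the orbit of `c a` under the completed configuration selected by `τ a`
(`E.bcBondConfig ω` if `τ a`, else `(shiftData E w).bcBondConfig ω`) runs through the
corresponding inner faces, joins the `r`-ball of `z` to distance `≥ R` from `z` (in either
direction), visits pairwise distinct corners, and two different stretches share no corner. -/
def ufrsStrands (E : DiscreteDobrushin) (w : Site 2) (z : ℂ) (k : ℕ) (r R : ℝ) : Set (BondConfig (Site 2)) :=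
  {ω | (∃ (c : Fin k → Site 2 × Fin 4) (i j : Fin k → ℕ) (τ : Fin k → Bool), (∀ a, i a ≤ j a ∧ ((dist (meshPoint E.δ (cornerOrbit (if τ a then E.bcBondConfig ω else (shiftData E w).bcBondConfig ω) (c a) (i a)).1) z ≤ r ∧ R ≤ dist (meshPoint E.δ (cornerOrbit (if τ a then E.bcBondConfig ω else (shiftData E w).bcBondConfig ω) (c a) (j a)).1) z) ∨ (R ≤ dist (meshPoint E.δ (cornerOrbit (if τ a then E.bcBondConfig ω else (shiftData E w).bcBondConfig ω) (c a) (i a)).1) z ∧ dist (meshPoint E.δ (cornerOrbit (if τ a then E.bcBondConfig ω else (shiftData E w).bcBondConfig ω) (c a) (j a)).1) z ≤ r)) ∧ (∀ t, i a ≤ t → t ≤ j a → if τ a then E.IsInnerFace (cFace (cornerOrbit (if τ a then E.bcBondConfig ω else (shiftData E w).bcBondConfig ω) (c a) t)) else (shiftData E w).IsInnerFace (cFace (cornerOrbit (if τ a then E.bcBondConfig ω else (shiftData E w).bcBondConfig ω) (c a) t))) ∧ (∀ s t, i a ≤ s → s < t → t ≤ j a → cornerOrbit (if τ a then E.bcBondConfig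 ω else (shiftData E w).bcBondConfig ω) (c a) s ≠ cornerOrbit (if τ a then E.bcBondConfig ω else (shiftData E w).bcBondConfig ω) (c a) t)) ∧ (∀ a b, a ≠ b → ∀ s t, i a ≤ s → s ≤ j a → i b ≤ t → t ≤ j b → cornerOrbit (if τ a then E.bcBondConfig ω else (shiftData E w).bcBondConfig ω) (c a) s ≠ cornerOrbit (if τ b then E.bcBondConfig ω else (shiftData E w).bcBondConfig ω) (c b) t))}

/-- Membership in `ufrsStrands`, unfolded (registered sub-goal `mem_ufrsStrands_iff`; by `Iff.rfl`). -/
theorem mem_ufrsStrands_iff : ∀ (E : DiscreteDobrushin) (w : Site 2) (z : ℂ) (k : ℕ) (r R : ℝ) (ω : BondConfig (Site 2)), ω ∈ ufrsStrands E w z k r R ↔ (∃ (c : Fin k → Site 2 × Fin 4) (i j : Fin k → ℕ) (τ : Fin k → Bool), (∀ a, i a ≤ j a ∧ ((dist (meshPoint E.δ (cornerOrbit (if τ a then E.bcBondConfig ω else (shiftData E w).bcBondConfig ω) (c a) (i a)).1) z ≤ r ∧ R ≤ dist (meshPoint E.δ (cornerOrbit (if τ a then E.bcBondConfig ω else (shiftData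 E w).bcBondConfig ω) (c a) (j a)).1) z) ∨ (R ≤ dist (meshPoint E.δ (cornerOrbit (if τ a then E.bcBondConfig ω else (shiftData E w).bcBondConfig ω) (c a) (i a)).1) z ∧ dist (meshPoint E.δ (cornerOrbit (if τ a then E.bcBondConfig ω else (shiftData E w).bcBondConfig ω) (c a) (j a)).1) z ≤ r)) ∧ (∀ t, i a ≤ t → t ≤ j a → if τ a then E.IsInnerFace (cFace (cornerOrbit (if τ a then E.bcBondConfig ω else (shiftData E w).bcBondConfig ω) (c a) t)) else (shiftData E w).IsInnerFace (cFace (cornerOrbit (if τ a then E.bcBondConfig ω else (shiftData E w).bcBondConfig ω) (c a) t))) ∧ (∀ s t, i a ≤ s → s < t → t ≤ j a → cornerOrbit (if τ a then E.bcBondConfig ω else (shiftData E w).bcBondConfig ω) (c a) s ≠ cornerOrbit (if τ a then E.bcBondConfig ω else (shiftData E w).bcBondConfig ω) (c a) t)) ∧ (∀ a b, a ≠ b → ∀ s t, i a ≤ s → s ≤ j a → i b ≤ t → t ≤ j b → cornerOrbit (if τ a then E.bcBondConfig ω else (shiftData E w).bcBondConfig ω) (c a) s ≠ cornerOrbit (if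 τ b then E.bcBondConfig ω else (shiftData E w).bcBondConfig ω) (c b) t)) :=
  fun _ _ _ _ _ _ _ => Iff.rfl

/-- **The neighbourhood of the marked edges**: the points `z` within `ρ'` of the midpoint of some
`A`–`B` edge of `E` or of `shiftData E w` (the discrete marked points `a_δ, b_δ` and their
translates). -/
def ufrsMarkedNbhd (E : DiscreteDobrushin) (w : Site 2) (ρ' : ℝ) : Set ℂ :=
  {z | (∃ e₀ : Sym2 (Site 2), (e₀ ∈ E.zdABEdges ∨ e₀ ∈ (shiftData E w).zdABEdges) ∧ dist (medialPoint E.δ e₀) z ≤ ρ')}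

/-- Membership in `ufrsMarkedNbhd`, unfolded. -/
theorem mem_ufrsMarkedNbhd_iff (E : DiscreteDobrushin) (w : Site 2) (ρ' : ℝ) (z : ℂ) :
    z ∈ ufrsMarkedNbhd E w ρ' ↔ (∃ e₀ : Sym2 (Site 2), (e₀ ∈ E.zdABEdges ∨ e₀ ∈ (shiftData E w).zdABEdges) ∧ dist (medialPoint E.δ e₀) z ≤ ρ') := Iff.rfl

/-- **The FAR branch of the certificate** at `z` (inner radius `r`, outer radius `R`): a dyadic
scale `d = R/2/2^k` with `r ≤ d`, `16 d ≤ R/2`, three strand-crossings of `A(z; r, d/2)` (if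
`2r ≤ d`) and three strand-crossings of `A(z; 2d, R/2)`. -/
def ufrsCertFar (E : DiscreteDobrushin) (w : Site 2) (z : ℂ) (r R : ℝ) : Set (BondConfig (Site 2)) :=
  {ω | ∃ d : ℝ, (∃ k : ℕ, d = R / 2 / 2 ^ k) ∧ r ≤ d ∧ 16 * d ≤ R / 2 ∧ (2 * r ≤ d → ω ∈ ufrsStrands E w z 3 r (d / 2)) ∧ ω ∈ ufrsStrands E w z 3 (2 * d) (R / 2)}

/-- Membership in `ufrsCertFar`, unfolded. -/
theorem mem_ufrsCertFar_iff (E : DiscreteDobrushin) (w : Site 2) (z : ℂ) (r R : ℝ) (ω : BondConfig (Site 2)) :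
    ω ∈ ufrsCertFar E w z r R ↔ ∃ d : ℝ, (∃ k : ℕ, d = R / 2 / 2 ^ k) ∧ r ≤ d ∧ 16 * d ≤ R / 2 ∧ (2 * r ≤ d → ω ∈ ufrsStrands E w z 3 r (d / 2)) ∧ ω ∈ ufrsStrands E w z 3 (2 * d) (R / 2) := Iff.rfl

/-- **The MARKED branch of the certificate**: dyadic `d` and outer radius `R' = R/2/2^(k+1)`,
`r ≤ d`, `16 d ≤ R'`, three strand-crossings of `A(z; r, d/2)` (if `2r ≤ d`) and of
`A(z; 2d, R')`, a marked edge within `4R'` of `z`, and two strand-crossings of `A(z; 8R', R/2)`. -/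
def ufrsCertMarked (E : DiscreteDobrushin) (w : Site 2) (z : ℂ) (r R : ℝ) : Set (BondConfig (Site 2)) :=
  {ω | ∃ d R' : ℝ, (∃ k : ℕ, d = R / 2 / 2 ^ k) ∧ (∃ k : ℕ, R' = R / 2 / 2 ^ (k + 1)) ∧ r ≤ d ∧ 16 * d ≤ R' ∧ (2 * r ≤ d → ω ∈ ufrsStrands E w z 3 r (d / 2)) ∧ ω ∈ ufrsStrands E w z 3 (2 * d) R' ∧ z ∈ ufrsMarkedNbhd E w (4 * R') ∧ ω ∈ ufrsStrands E w z 2 (8 * R') (R / 2)}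

/-- Membership in `ufrsCertMarked`, unfolded. -/
theorem mem_ufrsCertMarked_iff (E : DiscreteDobrushin) (w : Site 2) (z : ℂ) (r R : ℝ) (ω : BondConfig (Site 2)) :
    ω ∈ ufrsCertMarked E w z r R ↔ ∃ d R' : ℝ, (∃ k : ℕ, d = R / 2 / 2 ^ k) ∧ (∃ k : ℕ, R' = R / 2 / 2 ^ (k + 1)) ∧ r ≤ d ∧ 16 * d ≤ R' ∧ (2 * r ≤ d → ω ∈ ufrsStrands E w z 3 r (d / 2)) ∧ ω ∈ ufrsStrands E w z 3 (2 * d) R' ∧ z ∈ ufrsMarkedNbhd E w (4 * R') ∧ ω ∈ ufrsStrands E w z 2 (8 * R') (R / 2) := Iff.rfl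

/-- **The NEAR branch of the certificate**: a marked edge within `64 r` of `z` and two
strand-crossings of `A(z; 128 r, R/2)`. -/
def ufrsCertNear (E : DiscreteDobrushin) (w : Site 2) (z : ℂ) (r R : ℝ) : Set (BondConfig (Site 2)) :=
  {ω | z ∈ ufrsMarkedNbhd E w (64 * r) ∧ ω ∈ ufrsStrands E w z 2 (128 * r) (R / 2)}

/-- Membership in `ufrsCertNear`, unfolded. -/
theorem mem_ufrsCertNear_iff (E : DiscreteDobrushin) (w : Site 2) (z : ℂ) (r R : ℝ) (ω : BondConfig (Site 2)) :
    ω ∈ ufrsCertNear E w z r R ↔ z ∈ ufrsMarkedNbhd E w (64 * r) ∧ ω ∈ ufrsStrands E w z 2 (128 * r) (R / 2) := Iff.rfl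

/-- **The multi-scale certificate** at the collar point `z`: the degenerate escape `R < 256 r`
(as an event), or one of the branches FAR, MARKED, NEAR. This is the event family
`A E w z r R` fed to `ufrs_of_screenedArmDomination` (with `B := ∅`). -/
def ufrsCert (E : DiscreteDobrushin) (w : Site 2) (z : ℂ) (r R : ℝ) : Set (BondConfig (Site 2)) :=
  {_ω | R < 256 * r} ∪ ufrsCertFar E w z r R ∪ ufrsCertMarked E w z r R ∪ ufrsCertNear E w z r R

/-- Membership in `ufrsCert`, unfolded. -/
theorem mem_ufrsCert_iff (E : DiscreteDobrushin) (w : Site 2) (z : ℂ) (r R : ℝ) (ω : BondConfig (Site 2)) :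
    ω ∈ ufrsCert E w z r R ↔ ((R < 256 * r ∨ ω ∈ ufrsCertFar E w z r R) ∨ ω ∈ ufrsCertMarked E w z r R) ∨ ω ∈ ufrsCertNear E w z r R :=
  Iff.rfl

/-- **`k` arms of one configuration across an annulus**, as a set of configurations `β` (the
format of `Z2HalfPlane.threeArm` made local: colours `κ`, open arms = walks of `β`-open edges,
dual arms = face walks crossing edges outside `β`, endpoints within `r + 4δ` / beyond `R - 4δ`,
supports in the `4δ`-enlarged annulus, not all colours equal, same-colour arms edge-disjoint). -/
def ufrsArms (δ : ℝ) (z : ℂ) (k : ℕ) (r R : ℝ) : Set (BondConfig (Site 2)) :=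
  {β | (∃ (κ : Fin k → Bool) (x y : Fin k → Site 2) (W : ∀ a, (zdGraph 2).Walk (x a) (y a)), (∃ a b, κ a ≠ κ b) ∧ (∀ a, dist (meshPoint δ (x a)) z ≤ r + 4 * δ ∧ R - 4 * δ ≤ dist (meshPoint δ (y a)) z ∧ (∀ u ∈ (W a).support, r - 4 * δ ≤ dist (meshPoint δ u) z ∧ dist (meshPoint δ u) z ≤ R + 4 * δ) ∧ (κ a = true → ∀ e ∈ (W a).edges, e ∈ β) ∧ (κ a = false → ∀ e ∈ (W a).darts, sepEdge e.fst e.snd ∉ β)) ∧ Pairwise (fun a b => κ a = κ b → ∀ e ∈ (W a).edges, e ∉ (W b).edges))}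

/-- Membership in `ufrsArms`, unfolded. -/
theorem mem_ufrsArms_iff (δ : ℝ) (z : ℂ) (k : ℕ) (r R : ℝ) (β : BondConfig (Site 2)) :
    β ∈ ufrsArms δ z k r R ↔ (∃ (κ : Fin k → Bool) (x y : Fin k → Site 2) (W : ∀ a, (zdGraph 2).Walk (x a) (y a)), (∃ a b, κ a ≠ κ b) ∧ (∀ a, dist (meshPoint δ (x a)) z ≤ r + 4 * δ ∧ R - 4 * δ ≤ dist (meshPoint δ (y a)) z ∧ (∀ u ∈ (W a).support, r - 4 * δ ≤ dist (meshPoint δ u) z ∧ dist (meshPoint δ u) z ≤ R + 4 * δ) ∧ (κ a = true → ∀ e ∈ (W a).edges, e ∈ β) ∧ (κ a = false → ∀ e ∈ (W a).darts, sepEdge e.fst e.snd ∉ β)) ∧ Pairwise (fun a b => κ a = κ b → ∀ e ∈ (W a).edges, e ∉ (W b).edges)) := Iff.rfl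

end

end Summit.CriticalPhenomena.CardyFormulaZ2.Cruxes.EdgePrecompact.QkzStripBoundaryArm
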